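import Mathlib
import Summits.NavierStokesRegularity.NavierStokesRegularity.Theorems.CriticalCoherenceDoorDefs
import Literature.Analysis.FluidPDE.H1ContinuationSobolevClass
import Literature.Analysis.FluidPDE.NSFiniteEnergySmoothProofs
import HarnessLib

/-!
# Door S33 «CriticalCoherenceDoor» (ROUND-31, nsreg-p1 g27), plate P2 · SUB-CRITICAL ENSTROPHY CONTINUATION

S-door lane of the cell `ns-regularity-ideate` (LEAD ns-s30-p1 g2, PLATE MAP 2026-08-28T13:14:22Z item (4); texts of record
`r31/Sketch33.lean` sha16 ae52fe0f17f630b4, landed as `CalmPocketDoor…`'s sibling `CriticalCoherenceDoorDefs` (P0, p636457); plan PLATE-AID-33 §P2;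
hand ns-sfl-p1 g4, first free hand).  NO direction hypothesis here: a classical solution on `[0,T)` in the frame (all `L²` Sobolev seminorms
bounded below `T`) whose Dirichlet integral obeys the SUB-LERAY power bound `∫|∇u(t)|²_F ≤ K (T − t)^{−a}` on `[t₀, T)` with `a < 1/2`
continues past `T` in the Sobolev class.

Proof = the tree's restart-and-glue `hasSobolevExtensionPast_of_uniform_H1_bound` (H1ContinuationSobolevClass) WITH THE RESTART SLICE MOVED:
the energy `‖u(t)‖₂² ≤ Ē` on `[0,T)` comes from Tao's finite-energy class on every closed slab (`tao_finite_energy_smooth_energy_bound_holds`,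
the bookkeeping of `exists_uniform_H1_bound_of_holderHalf_direction`); with `K⁺ = max K 0`, `a⁺ = max a 0 < 1/2` the `H¹` level at a slice `s`
with `T − s = δ ≤ 1` is `A(δ) = Ē + K⁺ δ^{−a⁺}`, and `δ (A(δ)² + 1) = δ(Ē² + 1) + 2ĒK⁺ δ^{1−a⁺} + K⁺² δ^{1−2a⁺} → 0` as `δ ↓ 0` (both exponents are
POSITIVE because `2a⁺ < 1` — this is exactly where Leray's rate `1/2` enters); so some slice `s ∈ [t₀, T)` has Tao's `H¹` lifespan
`τ = cν³/(A² + 1) > T − s` (`tao2011_smooth_local_existence_holds`), uniqueness in the class (`MajdaBertozzi2002_uniquenessSobolev_holds`) identifies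
the restarted solution with `u`, and `HasSobolevExtensionPast.of_translate` glues.

* `subcriticalEnstrophyContinuation_holds : SubcriticalEnstrophyContinuation` — P2 BY NAME against P0.

WHAT THIS IS NOT: not NS regularity, not 0056 — one plate of door S33, a regularity CRITERION (Type-II-inclusive); `--supports` stmt-0056 as a
helper.  [cite: Leray1934, §20 (the rate (T−t)^{-1/2}); Tao2011, Thm. 5.4 (ii)+(iv); LemarieRieusset2016, Thm. 11.7 (proof)]
-/

noncomputable section

set_option linter.dupNamespace false

open MeasureTheory Set Function Filter Metric Real InnerProductSpace
open _root_.Topology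
open scoped ENNReal NNReal RealInnerProductSpace ContDiff
open Literature.Analysis.FluidPDE

namespace Summit.NavierStokesRegularity.NavierStokesRegularity.Theorems.CriticalCoherenceDoor

/-- **P2 · SUB-CRITICAL ENSTROPHY CONTINUATION (`SubcriticalEnstrophyContinuation`, BY NAME).**  For `ν > 0`, `0 ≤ t₀ < T`, `a < 1/2` and a
classical unforced Navier–Stokes solution on `ℝ³ × [0,T)` with all `L²` Sobolev seminorms bounded on every `[0,T'']`, `T'' < T`: if
`∫|∇u(t)|²_F ≤ K (T − t)^{−a}` for `t ∈ [t₀, T)`, then `u` continues past `T` in the class (`HasSobolevExtensionPast ν u T`).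
[cite: Tao2011, Thm. 5.4 (ii)+(iv); LemarieRieusset2016, Thm. 11.7 (proof); Leray1934, §20] -/
theorem subcriticalEnstrophyContinuation_holds : SubcriticalEnstrophyContinuation := by
  intro ν T t₀ K a hν ht₀ ht₀T ha u p hsol hreg hK
  obtain ⟨c, hc, hloc⟩ := tao2011_smooth_local_existence_holds
  have hT : 0 < T := lt_of_le_of_lt ht₀ ht₀T
  -- ### the energy level `Ē` on `[0, T)` (Tao's finite-energy class on every closed slab)
  obtain ⟨C, hCtop, hTao⟩ := tao_finite_energy_smooth_energy_bound_holds
  have hreg0 : HasBoundedSobolevNormsOn (Icc 0 (T / 2)) u := hreg (T / 2) (by linarith)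
  have h00 : (0 : ℝ) ∈ Icc 0 (T / 2) := ⟨le_rfl, by linarith⟩
  set E₀ : ℝ≥0∞ := ∫⁻ x, ‖u 0 x‖ₑ ^ 2 with hE₀
  have hE₀top : E₀ < ⊤ := by
    obtain ⟨C0, hC0⟩ := hreg0 0
    refine lt_of_le_of_lt (le_of_eq (lintegral_congr fun x => ?_)) ((hC0 0 h00).trans_lt ENNReal.coe_lt_top)
    rw [← ofReal_norm, ← ofReal_norm, norm_iteratedFDeriv_zero]
  have hCE : C * E₀ < ⊤ := ENNReal.mul_lt_top hCtop hE₀top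
  set Ē : ℝ := (C * E₀).toReal with hĒ
  have hĒ0 : 0 ≤ Ē := ENNReal.toReal_nonneg
  have hen : ∀ t ∈ Ico 0 T, ∫⁻ x, ‖u t x‖ₑ ^ 2 ≤ ENNReal.ofReal Ē := by
    intro t ht
    set T'' : ℝ := (t + T) / 2 with hT''def
    have htT'' : t < T'' := by rw [hT''def]; linarith [ht.2]
    have hT''T : T'' < T := by rw [hT''def]; linarith [ht.2]
    have hT''pos : 0 < T'' := lt_of_le_of_lt ht.1 htT''
    have hS : IsClassicalNSSolutionOn (Icc 0 T'') ν 0 u p :=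
      hsol.mono (Icc_subset_Ico_right hT''T) (uniqueDiffOn_Icc hT''pos)
    have hB : HasBoundedSobolevNormsOn (Icc 0 T'') u := hreg T'' hT''T
    have hfe : ∃ A : ℝ≥0∞, A < ⊤ ∧ ∀ s ∈ Icc 0 T'', ∫⁻ x, ‖u s x‖ₑ ^ 2 ≤ A := by
      obtain ⟨C0, hC0⟩ := hB 0
      refine ⟨C0, ENNReal.coe_lt_top, fun s hs => ?_⟩
      refine le_trans (le_of_eq (lintegral_congr fun x => ?_)) (hC0 s hs)
      rw [← ofReal_norm, ← ofReal_norm, norm_iteratedFDeriv_zero]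
    obtain ⟨hen', -⟩ := hTao ν T'' hν hT''pos u p hS hfe
    rw [hĒ, ENNReal.ofReal_toReal hCE.ne]
    exact hen' t ⟨ht.1, htT''.le⟩
  -- ### constants: `K⁺`, `a⁺ < 1/2`, and the lifespan function `g(δ) = δ (A(δ)² + 1)` expanded
  set K' : ℝ := max K 0 with hK'
  have hK'0 : 0 ≤ K' := le_max_right _ _
  set a' : ℝ := max a 0 with ha'
  have ha'0 : 0 ≤ a' := le_max_right _ _
  have ha'h : a' < 1 / 2 := max_lt ha (by norm_num)
  set g : ℝ → ℝ := fun δ => δ * (Ē ^ 2 + 1) + 2 * Ē * K' * δ ^ (1 - a') + K' ^ 2 * δ ^ (1 - 2 * a') with hg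
  have hlim : Tendsto g (𝓝 0) (𝓝 0) := by
    have h1 : Tendsto (fun δ : ℝ => δ ^ (1 - a')) (𝓝 0) (𝓝 0) := by
      have h := (Real.continuous_rpow_const (by linarith : (0 : ℝ) ≤ 1 - a')).tendsto 0
      rwa [Real.zero_rpow (by linarith : (1 : ℝ) - a' ≠ 0)] at h
    have h2 : Tendsto (fun δ : ℝ => δ ^ (1 - 2 * a')) (𝓝 0) (𝓝 0) := by
      have h := (Real.continuous_rpow_const (by linarith : (0 : ℝ) ≤ 1 - 2 * a')).tendsto 0
      rwa [Real.zero_rpow (by linarith : (1 : ℝ) - 2 * a' ≠ 0)] at h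
    have h0 : Tendsto (fun δ : ℝ => δ * (Ē ^ 2 + 1)) (𝓝 0) (𝓝 0) := by
      simpa using (tendsto_id (x := 𝓝 (0 : ℝ))).mul_const (Ē ^ 2 + 1)
    have h := (h0.add (h1.const_mul (2 * Ē * K'))).add (h2.const_mul (K' ^ 2))
    simpa [hg] using h
  have hcν : 0 < c * ν ^ 3 := by positivity
  obtain ⟨δ₀, hδ₀, hball⟩ := Metric.eventually_nhds_iff.1 (hlim.eventually (Iio_mem_nhds hcν))
  -- ### the restart gap `δ` and slice `s = T − δ ∈ [t₀, T)`
  set δ : ℝ := min (δ₀ / 2) (min 1 (T - t₀)) with hδdef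
  have hδ0 : 0 < δ := lt_min (by linarith) (lt_min one_pos (by linarith))
  have hδδ₀ : δ < δ₀ := lt_of_le_of_lt (min_le_left _ _) (by linarith)
  have hδ1 : δ ≤ 1 := (min_le_right _ _).trans (min_le_left _ _)
  have hδt₀ : δ ≤ T - t₀ := (min_le_right _ _).trans (min_le_right _ _)
  set s : ℝ := T - δ with hsdef
  have hst₀ : t₀ ≤ s := by rw [hsdef]; linarith
  have hs0 : 0 ≤ s := ht₀.trans hst₀
  have hsT : s < T := by rw [hsdef]; linarith
  have hsS : s ∈ Ico 0 T := ⟨hs0, hsT⟩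
  have hgδ : g δ < c * ν ^ 3 := hball (by rw [dist_zero_right, Real.norm_of_nonneg hδ0.le]; exact hδδ₀)
  -- ### the `H¹` level at the slice
  set A : ℝ := Ē + K' * δ ^ (-a') with hAdef
  have hδa : 0 < δ ^ (-a') := Real.rpow_pos_of_pos hδ0 _
  have hA0 : 0 ≤ A := by positivity
  have hA : (∫⁻ x, ‖u s x‖ₑ ^ 2) + (∫⁻ x, ENNReal.ofReal (frobeniusNormSq (fderiv ℝ (u s) x))) ≤ ENNReal.ofReal A := by
    have h1 := hen s hsS
    have h2 := hK s ⟨hst₀, hsT⟩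
    have hTs : T - s = δ := by rw [hsdef]; ring
    rw [hTs] at h2
    have h3 : K * δ ^ (-a) ≤ K' * δ ^ (-a') := by
      have hmono : δ ^ (-a) ≤ δ ^ (-a') :=
        Real.rpow_le_rpow_of_exponent_ge hδ0 hδ1 (neg_le_neg (le_max_left a 0))
      calc K * δ ^ (-a) ≤ K' * δ ^ (-a) := mul_le_mul_of_nonneg_right (le_max_left _ _) (Real.rpow_nonneg hδ0.le _)
        _ ≤ K' * δ ^ (-a') := mul_le_mul_of_nonneg_left hmono hK'0
    calc (∫⁻ x, ‖u s x‖ₑ ^ 2) + (∫⁻ x, ENNReal.ofReal (frobeniusNormSq (fderiv ℝ (u s) x)))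
        ≤ ENNReal.ofReal Ē + ENNReal.ofReal (K * δ ^ (-a)) := add_le_add h1 h2
      _ ≤ ENNReal.ofReal Ē + ENNReal.ofReal (K' * δ ^ (-a')) := by gcongr
      _ = ENNReal.ofReal A := by rw [hAdef, ENNReal.ofReal_add hĒ0 (by positivity)]
  -- ### Tao's lifespan from the slice exceeds the gap
  set τ : ℝ := c * ν ^ 3 / (A ^ 2 + 1) with hτ
  have hτpos : 0 < τ := by positivity
  have hsmall : A ^ 2 * τ ≤ c * ν ^ 3 :=
    calc A ^ 2 * τ ≤ (A ^ 2 + 1) * τ := by gcongr; linarith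
      _ = c * ν ^ 3 := by rw [hτ]; field_simp
  have hgap : T - s < τ := by
    have hTs : T - s = δ := by rw [hsdef]; ring
    have hexpand : δ * (A ^ 2 + 1) = g δ := by
      have e1 : δ * δ ^ (-a') = δ ^ (1 - a') := by
        rw [sub_eq_add_neg, Real.rpow_add hδ0, Real.rpow_one]
      have e2 : δ * (δ ^ (-a')) ^ 2 = δ ^ (1 - 2 * a') := by
        rw [show (1 : ℝ) - 2 * a' = 1 + (-a') * 2 by ring, Real.rpow_add hδ0, Real.rpow_one, Real.rpow_mul hδ0.le,
          Real.rpow_two]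
      simp only [hg, hAdef]
      have : δ * ((Ē + K' * δ ^ (-a')) ^ 2 + 1) =
          δ * (Ē ^ 2 + 1) + 2 * Ē * K' * (δ * δ ^ (-a')) + K' ^ 2 * (δ * (δ ^ (-a')) ^ 2) := by ring
      rw [this, e1, e2]
    rw [hTs, hτ, lt_div_iff₀ (by positivity), hexpand]
    exact hgδ
  -- ### restart at `s` (verbatim the tree's glue)
  have hregs : HasBoundedSobolevNormsOn (Icc 0 s) u := hreg s hsT
  have hus : ContDiff ℝ ∞ (u s) := hsol.contDiff_velocity hsS
  have hdiv : VectorCalculus.IsDivFree (u s) := hsol.divFree s hsS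
  have hHk : ∀ n : ℕ, ∫⁻ x, ‖iteratedFDeriv ℝ n (u s) x‖ₑ ^ 2 < ⊤ := fun n => by
    obtain ⟨C1, hC1⟩ := hregs n
    exact (hC1 s ⟨hs0, le_rfl⟩).trans_lt ENNReal.coe_lt_top
  obtain ⟨v, q, hv, hv0, hvB, -, -, -⟩ := hloc hν hτpos hus hdiv hHk hA0 hA hsmall
  -- uniqueness on `[0, T - s)`: `v = u (· + s)`
  have huniq : ∀ t ∈ Ico 0 (T - s), u (t + s) = v t := by
    intro t ht
    obtain ⟨ht0, htT⟩ := ht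
    set S : ℝ := (t + (T - s)) / 2 with hS
    have htS : t ≤ S := by linarith
    have hS' : S < T - s := by linarith
    have hSτ : S ≤ τ := by linarith
    have hS0 : 0 < S := by linarith
    have h1 : IsClassicalNSSolutionOn (Icc 0 S) ν 0 (fun r => u (r + s)) (fun r => p (r + s)) :=
      (hsol.translate_Ico_zero hs0).mono (Icc_subset_Ico_right hS') (uniqueDiffOn_Icc hS0)
    have h2 : IsClassicalNSSolutionOn (Icc 0 S) ν 0 v q :=
      hv.mono (Icc_subset_Icc_right hSτ) (uniqueDiffOn_Icc hS0)
    have hB1 : HasBoundedSobolevNormsOn (Icc 0 S) (fun r => u (r + s)) := by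
      have h := hreg (S + s) (by linarith)
      intro n
      obtain ⟨C1, hC1⟩ := h n
      exact ⟨C1, fun r hr => hC1 (r + s) ⟨by linarith [hr.1], by linarith [hr.2]⟩⟩
    have hB2 : HasBoundedSobolevNormsOn (Icc 0 S) v := hvB.mono (Icc_subset_Icc_right hSτ)
    have h0 : (fun r => u (r + s)) 0 = v 0 := by simp only [zero_add, hv0]
    exact MajdaBertozzi2002_uniquenessSobolev_holds hν.le hS0 h1 h2 hB1 hB2 h0 t ⟨ht0, htS⟩
  -- `v` continues the translate past `T - s`
  have hext : HasSobolevExtensionPast ν (fun t => u (t + s)) (T - s) :=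
    ⟨τ, hgap, v, q, hv.mono Ico_subset_Icc_self (uniqueDiffOn_Ico 0 τ),
      hvB.mono (Icc_subset_Icc_right (by linarith)), fun t ht => (huniq t ht).symm⟩
  exact HasSobolevExtensionPast.of_translate hsol hregs hs0 hsT hext

end Summit.NavierStokesRegularity.NavierStokesRegularity.Theorems.CriticalCoherenceDoor

end
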